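/-
Copyright (c) 2026 the pub-hodgecm-mathlib formalisation cell (harness21).  Prover seat hodgecm-mathlib-F0P3-p01 (g31), «(D-RAM) FOUR-FRAME» road of crux H413, line LH4, MS ROAD A,
STAGE B ∕ B56₂: «THE TUBE SUMMAND OF THE (R)-WEIGHT SUM AT A GENERAL CORNER and the EMPTY REGIMES» — predicate-free, corner-general twin of ★ F2 (LH4-p08 (g2)).  2026-09-04.
-/
import Summits.HodgeConjecture.HodgeConjecture.Theorems.F0P3cDyRamDiagonalGluedBoxCountCorner     -- ★ p856228 (this seat): `ncard_criterionR_glued_corner_eq`; brings ★ IndexCorner ∕ IndexFullCorner, ★ (iv-a) `exists_gl_coe_eq_glued`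
import Summits.HodgeConjecture.HodgeConjecture.Theorems.F0P3cDyRamDiagonalGluedStabilityCorner    -- ★ p856176 (this seat): corner stability congruences and depth corollaries
import Summits.HodgeConjecture.HodgeConjecture.Theorems.F0P3cDyRamDiagonalStratumTools           -- ★ (LH4-p13 (g2)): `finsum_mem_eq_ncard_mul`
import HarnessLib

/-!
# Crux `H413`, MS ROAD A, STAGE B ∕ B56₂: the glued stratum at a general corner — the TUBE SUMMAND of `Σ w` over the stable (R)-lattices, and the EMPTY regimes off the glue foot

Cell `hodgecm-mathlib` (D-0151), FLOOR 0, crux item H413 = `stmt-HodgeConjecture-24833`; lane `--supports stmt-HodgeConjecture-24833 --as helper` (count-neutral).  THEOREMS ONLY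
(no `def`, no instance, no notation, no `sorry`).  Twin of LH4-p08 (g2)'s B56 FILE F2 `F0P3cDyRamDiagonalGluedTubeContribution` (corner `2ρ + 2t`, DUALISABLE lattices) for the
frame `V(x,ζ,y″) = (1 0 0; x ϖ^ρ 0; xζ+y″ ϖ^ρζ ϖ^{2ρ+2t+e})` (`|x| = |ζ| = 1`, `|y″| = |ϖ|^{2t}`, `ρ ≥ 1`, any `e, t`) with DUALISABLE replaced by the raw γ-free criterion (R)
`∃ f = σf, |ζσy″ − σx·f| ≤ |ϖ|^{ρ+2t}` (so: no wild trace bound, no `t ≥ 1`; type 0 = ★ B5 (i) iff at `e = 0`; type 2 = LH4-p09 (g2)'s (i)₂ iff at `e = 1`).  Under the dealer's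
WORD #21 re-key of the type-2 heads on the polarisation multiplicity `n₂`, this `Σ w` is the `n₂`-FREE factor: the type-2 tube contribution is `n₂ · Σ w` with `n₂ ∈ {1, q}` constant
on the stratum (memo `F0/P3/F0P3-p01/g31/MEMO-typeTwo-glued-n2-parity.v1`).
* §1 `gluedR_stable_eq_gluedR_of_depths` — on the tube (`2ρ+2t+e ≤ n₁`, `2ρ+e ≤ n₂`, `ρ ≤ n₃`) the stability conjunct is automatic (★ p856176).
* §2 `stabiliserWeight_of_mem_gluedR_corner` — the weight is the constant `1∕(((q−1)q^{(ρ+2t+e+1)∕2−1})((q−1)q^{(2ρ+e+1)∕2−1}))` (★ p856076, (R) read off the set).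
* §3 `finsum_stabiliserWeight_gluedR_tube_corner_eq_mul` — `Σ w = #(R)-lattices × weight` in closed ℕ-products (★ p856228 count), any `e`; and the TYPE-2 letters
  **`finsum_stabiliserWeight_gluedR_tube_typeTwo_eq`**: corner `2ρ+1+2t`, tube `2ρ+1+2t ≤ n₁`, `2ρ+1 ≤ n₂`, `ρ ≤ n₃`: **`Σ w = (q−1)·q^{2ρ + t − 1 + ρ % 2}`** — for ODD ρ this is
  the B10₂ skeleton 08e5e6e2 tube value `(q−1)q^{2ρ+t}` (there `n₂ = 1`), for EVEN ρ it is `(q−1)q^{2ρ+t−1}` and the skeleton value is recovered as `n₂ · Σ w` with `n₂ = q`.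
* §4 `gluedR_stable_eq_empty_of_offFoot_corner`, `gluedR_stable_eq_empty_of_depth_lt_corner` — the empty regimes (★ p856176 `depths_of_mapGL_latt_hnf_glued_corner_eq`, (S2)).
HONEST LABEL.  Count-neutral (`--supports`); the census laws (MS) stay PROVER TARGETS until the Stage B ∕ B9 assemblies land (type-2 heads under re-key, dealer WORD #21);
`HC_CM` is proved only modulo the 7 printed citations (2 remaining named inputs: hLiu418 = `stmt-HodgeConjecture-24832`, h413 = `stmt-HodgeConjecture-24833`) until rung 0 closes.

## References
* [Kottwitz1986BaseChangeUnits] R. E. Kottwitz, *Base change for unit elements of Hecke algebras*, Compositio Math. 60 (1986), §1 pp. 240–241 (fixed-lattice counting by torus orbits).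
* [Rogawski1990] J. D. Rogawski, *Automorphic Representations of Unitary Groups in Three Variables*, Ann. of Math. Stud. 123 (1990), §4.9 Prop. 4.9.1 (a) p. 55.
* [Serre1979] J.-P. Serre, *Local Fields*, GTM 67 (1979), Ch. IV §2 Prop. 6.
-/

set_option autoImplicit false

noncomputable section

namespace Summit.HodgeConjecture.HodgeConjecture.Cruxes.H413.F0P3cDyRamDiagonalGluedTubeContributionCorner

open Matrix
open Literature.NumberTheory.Automorphic Literature.NumberTheory.Automorphic.HermitianLattice
open Literature.NumberTheory.Automorphic.UnitaryLatticeTree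
open Summit.HodgeConjecture.HodgeConjecture.Cruxes.H413.F0P3cDyRamDiagonalTorusDefs
open Summit.HodgeConjecture.HodgeConjecture.Cruxes.H413.F0P3cDyRamDiagonalGluedTorusOrbits (exists_gl_coe_eq_glued)
open Summit.HodgeConjecture.HodgeConjecture.Cruxes.H413.F0P3cDyRamDiagonalGluedStabiliserIndex (ne_zero_and_v_lt_one_of_v_eq_exp)
open Summit.HodgeConjecture.HodgeConjecture.Cruxes.H413.F0P3cDyRamDiagonalGluedStabiliserIndexCorner (relIndex_fixedUnitStabilizer_latt_glued_corner_eq)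
open Summit.HodgeConjecture.HodgeConjecture.Cruxes.H413.F0P3cDyRamDiagonalGluedStabilityCorner
open Summit.HodgeConjecture.HodgeConjecture.Cruxes.H413.F0P3cDyRamDiagonalGluedBoxCountCorner (ncard_criterionR_glued_corner_eq)
open Summit.HodgeConjecture.HodgeConjecture.Cruxes.H413.F0P3cDyRamDiagonalStratumTools (finsum_mem_eq_ncard_mul)
open scoped Valued WithZero Matrix MatrixGroups

variable {K : Type*} [Field K] [Valued K ℤᵐ⁰]

/-! ## §1 On the tube the stability conjunct is automatic -/

/-- **ON THE TUBE** (`2ρ + 2t + e ≤ n₁`, `2ρ + e ≤ n₂`, `ρ ≤ n₃`) every glued lattice at corner `2ρ+2t+e` is `T`-stable (★ p856176), so the stable (R)-family is the (R)-family.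
[cite: Kottwitz1986BaseChangeUnits, §1 pp. 240–241] -/
theorem gluedR_stable_eq_gluedR_of_depths (σ : K →+* K) {ϖ : K} (hϖ0 : ϖ ≠ 0) (hϖ1 : Valued.v ϖ ≤ 1) {α β : K} (hα : Valued.v α = 1) (hβ : Valued.v β = 1)
    (T : GL (Fin 3) K) (hT : (T : Matrix (Fin 3) (Fin 3) K) = Matrix.diagonal ![α, β, 1]) {n₁ n₂ n₃ : ℕ}
    (h₁ : Valued.v (β - 1) = Valued.v ϖ ^ n₁) (h₂ : Valued.v (α - 1) = Valued.v ϖ ^ n₂) (h₃ : Valued.v (β - α) = Valued.v ϖ ^ n₃)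
    (ρ t e : ℕ) (hρ₁ : 2 * ρ + 2 * t + e ≤ n₁) (hρ₂ : 2 * ρ + e ≤ n₂) (hρ₃ : ρ ≤ n₃) :
    {M : Submodule 𝒪[K] (Fin 3 → K) | ∃ x ζ y'' : K, Valued.v x = 1 ∧ Valued.v ζ = 1 ∧ Valued.v y'' = Valued.v ϖ ^ (2 * t) ∧
        M = latt (!![1, 0, 0; x, ϖ ^ ρ, 0; x * ζ + y'', ϖ ^ ρ * ζ, ϖ ^ (2 * ρ + 2 * t + e)] : Matrix (Fin 3) (Fin 3) K) ∧ mapGL T M = M ∧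
        ∃ f : K, σ f = f ∧ Valued.v (ζ * σ y'' - σ x * f) ≤ Valued.v ϖ ^ (ρ + 2 * t)} =
      {M | ∃ x ζ y'' : K, Valued.v x = 1 ∧ Valued.v ζ = 1 ∧ Valued.v y'' = Valued.v ϖ ^ (2 * t) ∧
        M = latt (!![1, 0, 0; x, ϖ ^ ρ, 0; x * ζ + y'', ϖ ^ ρ * ζ, ϖ ^ (2 * ρ + 2 * t + e)] : Matrix (Fin 3) (Fin 3) K) ∧
        ∃ f : K, σ f = f ∧ Valued.v (ζ * σ y'' - σ x * f) ≤ Valued.v ϖ ^ (ρ + 2 * t)} := by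
  ext M
  constructor
  · rintro ⟨x, ζ, y'', hx, hζ, hy'', hM, -, hR⟩
    exact ⟨x, ζ, y'', hx, hζ, hy'', hM, hR⟩
  · rintro ⟨x, ζ, y'', hx, hζ, hy'', hM, hR⟩
    obtain ⟨V, hV⟩ := exists_gl_coe_eq_glued x ζ y'' (pow_ne_zero ρ hϖ0) (pow_ne_zero (2 * ρ + 2 * t + e) hϖ0)
    refine ⟨x, ζ, y'', hx, hζ, hy'', hM, ?_, hR⟩
    rw [hM, ← hV]
    exact mapGL_latt_hnf_glued_corner_eq_of_depths hϖ0 hϖ1 hα hβ T hT h₁ h₂ h₃ ρ (2 * t) e hρ₁ hρ₂ hρ₃ hx hζ hy'' V hV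

/-! ## §2 The weight of a glued (R)-lattice at a general corner -/

/-- **THE WEIGHT IS CONSTANT ON THE GLUED (R)-FAMILY at corner `2ρ+2t+e`**: `w(M) = 1∕(((q−1)q^{(ρ+2t+e+1)∕2−1})·((q−1)q^{(2ρ+e+1)∕2−1}))` (★ p856076, the (R)-`f` read off the set).
[cite: Kottwitz1986BaseChangeUnits, §1 pp. 240–241] [cite: Rogawski1990, §4.9 Prop. 4.9.1 (a) p. 55] -/
theorem stabiliserWeight_of_mem_gluedR_corner {σ : K →+* K} (hσ : ∀ a, σ (σ a) = a) (hvσ : ∀ a, Valued.v (σ a) = Valued.v a)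
    (hfix : ∀ x : K, σ x = x → x ≠ 0 → ∃ n : ℤ, Valued.v x = WithZero.exp (2 * n)) {ϖ : K} (hϖ : Valued.v ϖ = WithZero.exp (-1 : ℤ))
    {d : ℕ} (hd : Valued.v (ϖ - σ ϖ) = Valued.v ϖ ^ d) [Finite 𝓀[K]] {ρ : ℕ} (hρ : 1 ≤ ρ) (t e : ℕ) {M : Submodule 𝒪[K] (Fin 3 → K)}
    (hM : M ∈ {M : Submodule 𝒪[K] (Fin 3 → K) | ∃ x ζ y'' : K, Valued.v x = 1 ∧ Valued.v ζ = 1 ∧ Valued.v y'' = Valued.v ϖ ^ (2 * t) ∧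
        M = latt (!![1, 0, 0; x, ϖ ^ ρ, 0; x * ζ + y'', ϖ ^ ρ * ζ, ϖ ^ (2 * ρ + 2 * t + e)] : Matrix (Fin 3) (Fin 3) K) ∧
        ∃ f : K, σ f = f ∧ Valued.v (ζ * σ y'' - σ x * f) ≤ Valued.v ϖ ^ (ρ + 2 * t)}) :
    stabiliserWeight σ M =
      ((((Nat.card 𝓀[K] - 1) * Nat.card 𝓀[K] ^ ((ρ + 2 * t + e + 1) / 2 - 1)) * ((Nat.card 𝓀[K] - 1) * Nat.card 𝓀[K] ^ ((2 * ρ + e + 1) / 2 - 1)) : ℕ) : ℚ)⁻¹ := by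
  obtain ⟨x, ζ, y'', hx, hζ, hy'', rfl, f, hf, hR⟩ := hM
  obtain ⟨hϖ0, -⟩ := ne_zero_and_v_lt_one_of_v_eq_exp hϖ
  obtain ⟨V, hV⟩ := exists_gl_coe_eq_glued x ζ y'' (pow_ne_zero ρ hϖ0) (pow_ne_zero (2 * ρ + 2 * t + e) hϖ0)
  rw [← hV]
  unfold stabiliserWeight
  rw [relIndex_fixedUnitStabilizer_latt_glued_corner_eq hσ hvσ hfix hϖ hd hρ (2 * t) e hx hζ hy'' V hV hf hR]

/-! ## §3 HEADS — the tube summand -/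

/-- **THE TUBE SUMMAND, general corner, as count × weight**: on the tube, `Σ_{M ∈ 𝒢_R(ρ, 2t; e), stable} w(M) = #𝒢_R · w` with ★ p856228's count `(q−1)³q^{3ρ+(ρ+1)∕2+2t+2e−3}`
and §2's weight. [cite: Kottwitz1986BaseChangeUnits, §1 pp. 240–241] [cite: Rogawski1990, §4.9 Prop. 4.9.1 (a) p. 55] -/
theorem finsum_stabiliserWeight_gluedR_tube_corner_eq_mul {σ : K →+* K} (hσ : ∀ a, σ (σ a) = a) (hvσ : ∀ a, Valued.v (σ a) = Valued.v a)
    (hfix : ∀ x : K, σ x = x → x ≠ 0 → ∃ n : ℤ, Valued.v x = WithZero.exp (2 * n)) {ϖ : K} (hϖ : Valued.v ϖ = WithZero.exp (-1 : ℤ))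
    {d : ℕ} (hd : Valued.v (ϖ - σ ϖ) = Valued.v ϖ ^ d) [Finite 𝓀[K]]
    {α β : K} (hα : Valued.v α = 1) (hβ : Valued.v β = 1) (T : GL (Fin 3) K) (hT : (T : Matrix (Fin 3) (Fin 3) K) = Matrix.diagonal ![α, β, 1])
    {n₁ n₂ n₃ : ℕ} (h₁ : Valued.v (β - 1) = Valued.v ϖ ^ n₁) (h₂ : Valued.v (α - 1) = Valued.v ϖ ^ n₂) (h₃ : Valued.v (β - α) = Valued.v ϖ ^ n₃)
    (ρ t e : ℕ) (hρ : 1 ≤ ρ) (hρ₁ : 2 * ρ + 2 * t + e ≤ n₁) (hρ₂ : 2 * ρ + e ≤ n₂) (hρ₃ : ρ ≤ n₃) :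
    ∑ᶠ M ∈ {M : Submodule 𝒪[K] (Fin 3 → K) | ∃ x ζ y'' : K, Valued.v x = 1 ∧ Valued.v ζ = 1 ∧ Valued.v y'' = Valued.v ϖ ^ (2 * t) ∧
        M = latt (!![1, 0, 0; x, ϖ ^ ρ, 0; x * ζ + y'', ϖ ^ ρ * ζ, ϖ ^ (2 * ρ + 2 * t + e)] : Matrix (Fin 3) (Fin 3) K) ∧ mapGL T M = M ∧
        ∃ f : K, σ f = f ∧ Valued.v (ζ * σ y'' - σ x * f) ≤ Valued.v ϖ ^ (ρ + 2 * t)},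
        stabiliserWeight σ M =
      (((Nat.card 𝓀[K] - 1) ^ 3 * Nat.card 𝓀[K] ^ (3 * ρ + (ρ + 1) / 2 + 2 * t + 2 * e - 3) : ℕ) : ℚ) *
        ((((Nat.card 𝓀[K] - 1) * Nat.card 𝓀[K] ^ ((ρ + 2 * t + e + 1) / 2 - 1)) * ((Nat.card 𝓀[K] - 1) * Nat.card 𝓀[K] ^ ((2 * ρ + e + 1) / 2 - 1)) : ℕ) : ℚ)⁻¹ := by
  obtain ⟨hϖ0, hϖ1⟩ := ne_zero_and_v_lt_one_of_v_eq_exp hϖ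
  have hq : 1 < Nat.card 𝓀[K] := Finite.one_lt_card
  have hcount := ncard_criterionR_glued_corner_eq hσ hvσ hfix hϖ hd ρ t e hρ
  have hne : (Nat.card 𝓀[K] - 1) ^ 3 * Nat.card 𝓀[K] ^ (3 * ρ + (ρ + 1) / 2 + 2 * t + 2 * e - 3) ≠ 0 :=
    mul_ne_zero (pow_ne_zero _ (by omega)) (pow_ne_zero _ (by omega))
  have hfin := Set.finite_of_ncard_ne_zero (hcount ▸ hne)
  rw [gluedR_stable_eq_gluedR_of_depths σ hϖ0 hϖ1.le hα hβ T hT h₁ h₂ h₃ ρ t e hρ₁ hρ₂ hρ₃,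
    finsum_mem_eq_ncard_mul hfin _ _ (fun M hM => stabiliserWeight_of_mem_gluedR_corner hσ hvσ hfix hϖ hd hρ t e hM), hcount]

/-- **TYPE 2 — THE TUBE SUMMAND `Σ w = (q−1)·q^{2ρ+t−1+ρ%2}`** on the glued stratum `G₁(2ρ+1, 2t)` (corner `2ρ+1+2t`; tube `2ρ+1+2t ≤ n₁`, `2ρ+1 ≤ n₂`, `ρ ≤ n₃`; (R) = LH4-p09 (g2)'s
(i)₂ letters): `(q−1)³q^{3ρ+⌈ρ∕2⌉+2t−1}` lattices (★ p856228) of weight `1∕((q−1)²q^{⌊ρ∕2⌋+t+ρ})` (★ p856076).  For EVEN ρ the B10₂ skeleton value `(q−1)q^{2ρ+t}` is `q` times this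
(`n₂ = q` polarisation cosets per lattice); for ODD ρ they agree. [cite: Kottwitz1986BaseChangeUnits, §1 pp. 240–241] [cite: Rogawski1990, §4.9 Prop. 4.9.1 (a) p. 55] -/
theorem finsum_stabiliserWeight_gluedR_tube_typeTwo_eq {σ : K →+* K} (hσ : ∀ a, σ (σ a) = a) (hvσ : ∀ a, Valued.v (σ a) = Valued.v a)
    (hfix : ∀ x : K, σ x = x → x ≠ 0 → ∃ n : ℤ, Valued.v x = WithZero.exp (2 * n)) {ϖ : K} (hϖ : Valued.v ϖ = WithZero.exp (-1 : ℤ))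
    {d : ℕ} (hd : Valued.v (ϖ - σ ϖ) = Valued.v ϖ ^ d) [Finite 𝓀[K]]
    {α β : K} (hα : Valued.v α = 1) (hβ : Valued.v β = 1) (T : GL (Fin 3) K) (hT : (T : Matrix (Fin 3) (Fin 3) K) = Matrix.diagonal ![α, β, 1])
    {n₁ n₂ n₃ : ℕ} (h₁ : Valued.v (β - 1) = Valued.v ϖ ^ n₁) (h₂ : Valued.v (α - 1) = Valued.v ϖ ^ n₂) (h₃ : Valued.v (β - α) = Valued.v ϖ ^ n₃)
    (ρ t : ℕ) (hρ : 1 ≤ ρ) (hρ₁ : 2 * ρ + 1 + 2 * t ≤ n₁) (hρ₂ : 2 * ρ + 1 ≤ n₂) (hρ₃ : ρ ≤ n₃) :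
    ∑ᶠ M ∈ {M : Submodule 𝒪[K] (Fin 3 → K) | ∃ x ζ y'' : K, Valued.v x = 1 ∧ Valued.v ζ = 1 ∧ Valued.v y'' = Valued.v ϖ ^ (2 * t) ∧
        M = latt (!![1, 0, 0; x, ϖ ^ ρ, 0; x * ζ + y'', ϖ ^ ρ * ζ, ϖ ^ (2 * ρ + 1 + 2 * t)] : Matrix (Fin 3) (Fin 3) K) ∧ mapGL T M = M ∧
        ∃ f : K, σ f = f ∧ Valued.v (ζ * σ y'' - σ x * f) ≤ Valued.v ϖ ^ (ρ + 2 * t)},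
        stabiliserWeight σ M = ((Nat.card 𝓀[K] : ℚ) - 1) * (Nat.card 𝓀[K] : ℚ) ^ (2 * ρ + t - 1 + ρ % 2) := by
  have hq : 1 < Nat.card 𝓀[K] := Finite.one_lt_card
  -- exponent bookkeeping: `A = E + B₁ + B₂` with `(q−1)³ ∕ (q−1)² = q−1`
  have hB : 3 * ρ + (ρ + 1) / 2 + 2 * t + 2 * 1 - 3 = (2 * ρ + t - 1 + ρ % 2) + (((ρ + 2 * t + 1 + 1) / 2 - 1) + ((2 * ρ + 1 + 1) / 2 - 1)) := by
    rcases Nat.even_or_odd ρ with ⟨m, hm⟩ | ⟨m, hm⟩ <;> subst hm <;> omega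
  have h := finsum_stabiliserWeight_gluedR_tube_corner_eq_mul hσ hvσ hfix hϖ hd hα hβ T hT h₁ h₂ h₃ ρ t 1 hρ (by omega) (by omega) hρ₃
  rw [show 2 * ρ + 2 * t + 1 = 2 * ρ + 1 + 2 * t by ring] at h
  rw [h, hB, pow_add, pow_add]
  have hq1 : ((Nat.card 𝓀[K] : ℚ) - 1) ≠ 0 := sub_ne_zero.2 (by exact_mod_cast hq.ne')
  have hq0 : (Nat.card 𝓀[K] : ℚ) ≠ 0 := by exact_mod_cast (by omega : Nat.card 𝓀[K] ≠ 0)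
  push_cast [Nat.cast_sub hq.le]
  field_simp
  ring

/-! ## §4 The empty regimes off the glue foot, general corner -/

/-- **OFF THE FOOT AND BELOW THE TUBE THERE IS NOTHING**, general corner: if `n₁ ≠ n₂ + 2t` then a `T`-stable glued lattice forces `2ρ + 2t + e ≤ n₁ ∧ 2ρ + e ≤ n₂` (★ p856176), so
below the tube the stable (R)-family is empty. [cite: Kottwitz1986BaseChangeUnits, §1 pp. 240–241] -/
theorem gluedR_stable_eq_empty_of_offFoot_corner (σ : K →+* K) {ϖ : K} (hϖ0 : ϖ ≠ 0) (hϖ1 : Valued.v ϖ < 1) {α β : K} (hα : Valued.v α = 1) (hβ : Valued.v β = 1)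
    (T : GL (Fin 3) K) (hT : (T : Matrix (Fin 3) (Fin 3) K) = Matrix.diagonal ![α, β, 1]) {n₁ n₂ : ℕ}
    (h₁ : Valued.v (β - 1) = Valued.v ϖ ^ n₁) (h₂ : Valued.v (α - 1) = Valued.v ϖ ^ n₂) (ρ t e : ℕ) (hne : n₁ ≠ n₂ + 2 * t)
    (hlow : ¬ (2 * ρ + 2 * t + e ≤ n₁ ∧ 2 * ρ + e ≤ n₂)) :
    {M : Submodule 𝒪[K] (Fin 3 → K) | ∃ x ζ y'' : K, Valued.v x = 1 ∧ Valued.v ζ = 1 ∧ Valued.v y'' = Valued.v ϖ ^ (2 * t) ∧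
        M = latt (!![1, 0, 0; x, ϖ ^ ρ, 0; x * ζ + y'', ϖ ^ ρ * ζ, ϖ ^ (2 * ρ + 2 * t + e)] : Matrix (Fin 3) (Fin 3) K) ∧ mapGL T M = M ∧
        ∃ f : K, σ f = f ∧ Valued.v (ζ * σ y'' - σ x * f) ≤ Valued.v ϖ ^ (ρ + 2 * t)} = ∅ := by
  ext M
  simp only [Set.mem_setOf_eq, Set.mem_empty_iff_false, iff_false]
  rintro ⟨x, ζ, y'', hx, hζ, hy'', rfl, hstab, -⟩
  obtain ⟨V, hV⟩ := exists_gl_coe_eq_glued x ζ y'' (pow_ne_zero ρ hϖ0) (pow_ne_zero (2 * ρ + 2 * t + e) hϖ0)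
  rw [← hV] at hstab
  exact hlow (depths_of_mapGL_latt_hnf_glued_corner_eq hϖ0 hϖ1 hα hβ T hT h₁ h₂ ρ (2 * t) e hne hx hζ hy'' V hV hstab)

/-- **TOO SHALLOW A ROOT**, general corner: if `n₃ < ρ` no glued lattice is `T`-stable (the first stability congruence `|(β − α)x| ≤ |ϖ|^ρ` fails), so the family is empty.
[cite: Kottwitz1986BaseChangeUnits, §1 pp. 240–241] -/
theorem gluedR_stable_eq_empty_of_depth_lt_corner (σ : K →+* K) {ϖ : K} (hϖ : Valued.v ϖ = WithZero.exp (-1 : ℤ)) {α β : K} (hα : Valued.v α = 1) (hβ : Valued.v β = 1)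
    (T : GL (Fin 3) K) (hT : (T : Matrix (Fin 3) (Fin 3) K) = Matrix.diagonal ![α, β, 1]) {n₃ : ℕ} (h₃ : Valued.v (β - α) = Valued.v ϖ ^ n₃)
    (ρ t e : ℕ) (hlt : n₃ < ρ) :
    {M : Submodule 𝒪[K] (Fin 3 → K) | ∃ x ζ y'' : K, Valued.v x = 1 ∧ Valued.v ζ = 1 ∧ Valued.v y'' = Valued.v ϖ ^ (2 * t) ∧
        M = latt (!![1, 0, 0; x, ϖ ^ ρ, 0; x * ζ + y'', ϖ ^ ρ * ζ, ϖ ^ (2 * ρ + 2 * t + e)] : Matrix (Fin 3) (Fin 3) K) ∧ mapGL T M = M ∧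
        ∃ f : K, σ f = f ∧ Valued.v (ζ * σ y'' - σ x * f) ≤ Valued.v ϖ ^ (ρ + 2 * t)} = ∅ := by
  obtain ⟨hϖ0, hϖ1⟩ := ne_zero_and_v_lt_one_of_v_eq_exp hϖ
  have hvϖ : 0 < Valued.v ϖ := (Valuation.pos_iff _).2 hϖ0
  ext M
  simp only [Set.mem_setOf_eq, Set.mem_empty_iff_false, iff_false]
  rintro ⟨x, ζ, y'', hx, hζ, hy'', rfl, hstab, -⟩
  obtain ⟨V, hV⟩ := exists_gl_coe_eq_glued x ζ y'' (pow_ne_zero ρ hϖ0) (pow_ne_zero (2 * ρ + 2 * t + e) hϖ0)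
  rw [← hV] at hstab
  have h := ((mapGL_latt_hnf_glued_corner_eq_iff hϖ0 hα hβ T hT ρ (2 * t) e x ζ y'' V hV).1 hstab).1
  rw [map_mul, hx, mul_one, h₃, pow_le_pow_iff_right_of_lt_one₀ hvϖ hϖ1] at h
  omega

end Summit.HodgeConjecture.HodgeConjecture.Cruxes.H413.F0P3cDyRamDiagonalGluedTubeContributionCorner

end
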